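import Summits.Ventures.HodgeRepro2.T5RecordSphericalSpectrumInertToy
import Summits.Ventures.HodgeRepro2.T5CyclotomicFourInertPrime

/-!
# The unramified spectrum of the record's pair on `ℚ(i)` at EVERY inert place `(p)`, `p ≡ 3 (mod 4)`: `q = p`

Tier-5 support N3 / §G-N4.2 (seat p3, gen 87). File 345 read file 344's unramified-spectrum theorem on the lane's
second toy field `L = ℚ(ζ₄) = ℚ(i)` at the inert place `(3)` (`q = 3`). This file reads it at EVERY place
`vPrime L p h2` of `ℚ(i)⁺ = ℚ` above a rational prime `p` of order `2` modulo `4` (`p ≡ 3 (mod 4)`: `3, 7, 11, 19, …`;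
the places of file 259 `T5CyclotomicFourInertPrime`, which stay prime in `ℚ(i)` with `N(v) = p`), so that the Satake
parameter reads `α · p⁻²`, and (file 354) at `p = 7` as a numeral (`q = 7`, `α / 49`) — the `ℚ(i)` companion of files 350 / 351
on the field of record `ℚ(ζ₇)`:

* `absNorm_vPrime_cast` — `N(vPrime) = p` in any field `k`;
* **`exists_mulEquiv_forall_nonempty_equiv_inertSphericalQuot_record_four_inert`** — for any fourth cyclotomic
  extension `L`, any prime `p ≡ 3 (mod 4)`, any datum `(θ, y)` and any generators `l`: `u₀ ∈ 𝒪_{ℚ_p}ˣ`,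
  `Φ : U(J₃(u₀)) ≃* U(1 ⊗ H₀)` matching the hyperspecial subgroups, a star-fixed uniformiser `ϖ'` of `𝒪_{ℚ_p(i)}`,
  and every irreducible `K_v`-finite representation of `U(1 ⊗ H₀)` with non-zero finite-dimensional `K_v`-invariants
  `≅ (inertSphericalQuot (α · (p²)⁻¹)) ∘ Φ⁻¹` for some `α ≠ 0`;
* **`…_record_four_inert_zeta`** — the same with the explicit datum `(θ, y) = (−1, ζ₄)` of file 345;
* `exists_generators_and_…_record_four_inert_zeta` — with the generators `l` supplied by file 235: the whole
  hypothesis set of file 344's statement is inhabited on `ℚ(i)` at every inert place;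
* the numeral `p = 7` (`q = 7`) is file 354 (`T5RecordSphericalSpectrumFourSeven`).

With files 345 / 350 / 351, rows 12–14's principal-series identification is kernel at EVERY inert place of BOTH toy
fields of the lane. §8(d): uses an L-value-free non-vanishing device: NO.
-/

open Matrix NumberField NumberField.IsCMField IsDedekindDomain IsDedekindDomain.HeightOneSpectrum Module
  MulAction
open scoped TensorProduct Pointwise
open Summit.Ventures.HodgeRepro2.T5UnitaryGroupForm Summit.Ventures.HodgeRepro2.T5UnitaryHeckeAdjoint
  Summit.Ventures.HodgeRepro2.T5HeckePermutationModule Summit.Ventures.HodgeRepro2.LevelPositivity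
  Summit.Ventures.HodgeRepro2.T5LevelIdempotent Summit.Ventures.HodgeRepro2.T5StarOfInvolution
  Summit.Ventures.HodgeRepro2.T5FinitePlaceCM Summit.Ventures.HodgeRepro2.T5NonSplitPlaceUnitaryGroup
  Summit.Ventures.HodgeRepro2.T5RecordHyperspecial Summit.Ventures.HodgeRepro2.T5GlobalLatticeAlmostAll
  Summit.Ventures.HodgeRepro2.T5HermitianThreeElements Summit.Ventures.HodgeRepro2.T5GaloisCartanThree
  Summit.Ventures.HodgeRepro2.T5InertDegreeGalois Summit.Ventures.HodgeRepro2.T5InertPlaceCompletion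
  Summit.Ventures.HodgeRepro2.T5InertDegreeAdicCompletion Summit.Ventures.HodgeRepro2.T5InertSatakeTransform
  Summit.Ventures.HodgeRepro2.T5InertSatakeTransformCompletion Summit.Ventures.HodgeRepro2.T5InertUnipotentResidue
  Summit.Ventures.HodgeRepro2.T5InertSphericalSubquotient Summit.Ventures.HodgeRepro2.T5RecordSatakeCell
  Summit.Ventures.HodgeRepro2.T5SplitPlaceUnitaryGroup Summit.Ventures.HodgeRepro2.T5FinitePlaceNormIndex
  Summit.Ventures.HodgeRepro2.T5HermitianLocalIsotropyN3 Summit.Ventures.HodgeRepro2.T5FinitePlaceSplitClassification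
  Summit.Ventures.HodgeRepro2.T5InertDegreeCompletion Summit.Ventures.HodgeRepro2.T5InertPlaceCompletionCells
  Summit.Ventures.HodgeRepro2.T5RecordSatake Summit.Ventures.HodgeRepro2.T5CartanCellsDistinct
  Summit.Ventures.HodgeRepro2.T5RecordSatakeInert Summit.Ventures.HodgeRepro2.T5InertGlobalPrime
  Summit.Ventures.HodgeRepro2.T5CMFieldSquareDatum Summit.Ventures.HodgeRepro2.T5RecordSatakeDegree
  Summit.Ventures.HodgeRepro2.T5RecordSatakeDegreeIntrinsic Summit.Ventures.HodgeRepro2.T5RecordSphericalSpectrum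
  Summit.Ventures.HodgeRepro2.T5RecordSphericalSpectrumIntrinsic Summit.Ventures.HodgeRepro2.T5RecordSatakeToy
  Summit.Ventures.HodgeRepro2.T5RecordSatakeInertToy Summit.Ventures.HodgeRepro2.T5RecordSatakeInertToyDegree
  Summit.Ventures.HodgeRepro2.T5CMCensusToy Summit.Ventures.HodgeRepro2.T5RecordSphericalSpectrumInertToy
  Summit.Ventures.HodgeRepro2.T5CyclotomicFourInertPrime

namespace Summit.Ventures.HodgeRepro2.T5RecordSphericalSpectrumFourInertPrime

universe uV

section Generic

variable (L : Type*) [Field L] [CharZero L] [IsCyclotomicExtension {2 ^ 2} ℚ L] [NumberField L] [IsCMField L]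
variable (p : ℕ) [hp : Fact p.Prime] (h2 : orderOf (p : ZMod (2 ^ 2)) = 2)
variable {θ : maximalRealSubfield L} {y : L}
  (hθ : algebraMap (maximalRealSubfield L) L θ = y ^ 2) (hy : complexConj L y ≠ y)
variable {r : ℕ} (l : Fin r → 𝓞 L) (k : Type*) [Field k] [CharZero k] [IsAlgClosed k]

omit [IsCMField L] [CharZero k] [IsAlgClosed k] in
/-- `N(vPrime) = p` read in any field `k` (file 259's `absNorm_vPrime`). -/
theorem absNorm_vPrime_cast : (Ideal.absNorm (vPrime L p h2).asIdeal : k) = p := by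
  have h : Ideal.absNorm (vPrime L p h2).asIdeal = p := absNorm_vPrime L p h2
  rw [h]

include hθ hy in
/-- **THE UNRAMIFIED SPECTRUM OF THE RECORD'S PAIR ON `ℚ(i)` AT EVERY INERT PLACE `(p)`, `p ≡ 3 (mod 4)`, `q = p`**
(file 344's `exists_mulEquiv_forall_nonempty_equiv_inertSphericalQuot_record_of_staysPrime` with `hmap := map_vPrime`,
`H := H₀ = diag(1, 1, −1)`, `q' = p`): for any prime `p` with `orderOf (p : ZMod 4) = 2`, any datum `(θ, y)` and any
generators `l`: `u₀ ∈ 𝒪_{ℚ_p}ˣ`, `Φ : U(J₃(u₀)) ≃* U(1 ⊗ H₀)` matching the hyperspecial subgroups, a star-fixed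
uniformiser `ϖ'` of `𝒪_{ℚ_p(i)}`, and every irreducible `K_v`-finite representation of `U(1 ⊗ H₀)` with non-zero
finite-dimensional `K_v`-invariants `≅ (inertSphericalQuot (α · (p²)⁻¹)) ∘ Φ⁻¹` for some `α ≠ 0`. -/
theorem exists_mulEquiv_forall_nonempty_equiv_inertSphericalQuot_record_four_inert
    (hl : Submodule.span (𝓞 (maximalRealSubfield L)) (Set.range l) = ⊤) :
    letI := tensorStarRing L (vPrime L p h2)
    letI := starRingOfQuadratic (finrank_eq_two L (vPrime L p h2) (wPrime L p h2) hθ hy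
        (not_isSquare_of_staysPrime L (vPrime L p h2) (wPrime L p h2) hθ hy (map_vPrime L p h2)))
      (localConj (vPrime L p h2) (wPrime L p h2) hθ.symm (span_pair_eq_top L hy)
        (not_isSquare_of_staysPrime L (vPrime L p h2) (wPrime L p h2) hθ hy (map_vPrime L p h2))
        (complexConj L))
      (localConj_ne_one (vPrime L p h2) (wPrime L p h2) hθ.symm (span_pair_eq_top L hy)
        (not_isSquare_of_staysPrime L (vPrime L p h2) (wPrime L p h2) hθ hy (map_vPrime L p h2))
        (complexConj L) (complexConj_apply_eq_neg L hθ hy))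
    haveI := isDiscreteValuationRing_integralClosure_adicCompletion (vPrime L p h2) (wPrime L p h2)
    haveI := finite_residueField_integralClosure_adicCompletion (vPrime L p h2) (wPrime L p h2)
    haveI : IsFractionRing (integralClosure ((vPrime L p h2).adicCompletionIntegers (maximalRealSubfield L))
        ((wPrime L p h2).adicCompletion L)) ((wPrime L p h2).adicCompletion L) :=
      integralClosure.isFractionRing_of_finite_extension ((vPrime L p h2).adicCompletion (maximalRealSubfield L))
        ((wPrime L p h2).adicCompletion L)
    ∃ (u₀ : ((vPrime L p h2).adicCompletionIntegers (maximalRealSubfield L))ˣ)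
      (Φ : ↥(formUnitaryGroup (J3 (algebraMap ((vPrime L p h2).adicCompletionIntegers (maximalRealSubfield L))
        ((wPrime L p h2).adicCompletion L)
        (u₀ : (vPrime L p h2).adicCompletionIntegers (maximalRealSubfield L))))) ≃*
        ↥(formUnitaryGroup (tensorGram L (vPrime L p h2) (gramToy L))))
      (ϖ' : integralClosure ((vPrime L p h2).adicCompletionIntegers (maximalRealSubfield L))
        ((wPrime L p h2).adicCompletion L))
      (hϖ' : Irreducible ϖ')
      (hs' : star (algebraMap (integralClosure ((vPrime L p h2).adicCompletionIntegers (maximalRealSubfield L))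
        ((wPrime L p h2).adicCompletion L)) ((wPrime L p h2).adicCompletion L) ϖ') =
          algebraMap (integralClosure ((vPrime L p h2).adicCompletionIntegers (maximalRealSubfield L))
            ((wPrime L p h2).adicCompletion L)) ((wPrime L p h2).adicCompletion L) ϖ'),
      (∀ g, g ∈ hyperspecialSubgroup
          (integralClosure ((vPrime L p h2).adicCompletionIntegers (maximalRealSubfield L))
            ((wPrime L p h2).adicCompletion L))
          (J3 (algebraMap ((vPrime L p h2).adicCompletionIntegers (maximalRealSubfield L))
            ((wPrime L p h2).adicCompletion L)
            (u₀ : (vPrime L p h2).adicCompletionIntegers (maximalRealSubfield L)))) ↔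
          Φ g ∈ recordHyperspecial L (vPrime L p h2) l (gramToy L)) ∧
      ∀ {V : Type uV} [AddCommGroup V] [Module k V]
        (ρ : Representation k (↥(formUnitaryGroup (tensorGram L (vPrime L p h2) (gramToy L)))) V) [ρ.IsIrreducible],
        KFinite ρ (recordHyperspecial L (vPrime L p h2) l (gramToy L)) →
        ∀ [FiniteDimensional k (invariants ρ (recordHyperspecial L (vPrime L p h2) l (gramToy L)))],
        invariants ρ (recordHyperspecial L (vPrime L p h2) l (gramToy L)) ≠ ⊥ →
        ∃ α : k, α ≠ 0 ∧ Nonempty (ρ.Equiv (comp Φ.symm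
          (inertSphericalQuot
            (hstar_of_star_eq (localConj (vPrime L p h2) (wPrime L p h2) hθ.symm (span_pair_eq_top L hy)
              (not_isSquare_of_staysPrime L (vPrime L p h2) (wPrime L p h2) hθ hy (map_vPrime L p h2))
              (complexConj L))
              (fun x => by
                rw [star_p8_eq_star L (vPrime L p h2) (wPrime L p h2) hθ hy
                  (not_isSquare_of_staysPrime L (vPrime L p h2) (wPrime L p h2) hθ hy
                    (map_vPrime L p h2))]
                rfl))
            (algebraMap ((vPrime L p h2).adicCompletionIntegers (maximalRealSubfield L))
              ((wPrime L p h2).adicCompletion L)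
              (u₀ : (vPrime L p h2).adicCompletionIntegers (maximalRealSubfield L)))
            (star_algebraMap_of_star_eq (localConj (vPrime L p h2) (wPrime L p h2) hθ.symm
              (span_pair_eq_top L hy)
              (not_isSquare_of_staysPrime L (vPrime L p h2) (wPrime L p h2) hθ hy (map_vPrime L p h2))
              (complexConj L))
              (fun x => by
                rw [star_p8_eq_star L (vPrime L p h2) (wPrime L p h2) hθ hy
                  (not_isSquare_of_staysPrime L (vPrime L p h2) (wPrime L p h2) hθ hy
                    (map_vPrime L p h2))]
                rfl)
              (u₀ : (vPrime L p h2).adicCompletionIntegers (maximalRealSubfield L)))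
            (algebraMap_unit_ne_zero (F := (vPrime L p h2).adicCompletion (maximalRealSubfield L)) u₀)
            (isInteger_algebraMap (u₀ : (vPrime L p h2).adicCompletionIntegers (maximalRealSubfield L)))
            (isInteger_algebraMap_unit_inv u₀) hϖ' hs' k (α * ((p : k) ^ 2)⁻¹)))) :=
  exists_mulEquiv_forall_nonempty_equiv_inertSphericalQuot_record_of_staysPrime L (vPrime L p h2)
    (wPrime L p h2) hθ hy (map_vPrime L p h2) l k (p : k) (absNorm_vPrime_cast L p h2 k) hl
    gramToy_isHermitian isUnit_det_gramToy (notMem_badSet_gramToy _)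

/-- **THE SAME WITH THE EXPLICIT DATUM `(θ, y) = (−1, ζ₄)`** of `ℚ(i)` (file 345's `neg_one_eq_zeta_sq`,
`complexConj_zeta_ne`): the unramified spectrum of `(U(1 ⊗ H₀), K_{(p)})` at every inert place `(p)` of `ℚ(i)`,
Satake parameter `α · (p²)⁻¹`, for any generators `l` of `𝓞_{ℚ(i)}` over `𝓞_{ℚ(i)⁺}`. -/
theorem exists_mulEquiv_forall_nonempty_equiv_inertSphericalQuot_record_four_inert_zeta
    (hl : Submodule.span (𝓞 (maximalRealSubfield L)) (Set.range l) = ⊤) :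
    letI := tensorStarRing L (vPrime L p h2)
    letI := starRingOfQuadratic (finrank_eq_two L (vPrime L p h2) (wPrime L p h2) (neg_one_eq_zeta_sq L) (complexConj_zeta_ne L)
        (not_isSquare_of_staysPrime L (vPrime L p h2) (wPrime L p h2) (neg_one_eq_zeta_sq L) (complexConj_zeta_ne L) (map_vPrime L p h2)))
      (localConj (vPrime L p h2) (wPrime L p h2) (neg_one_eq_zeta_sq L).symm (span_pair_eq_top L (complexConj_zeta_ne L))
        (not_isSquare_of_staysPrime L (vPrime L p h2) (wPrime L p h2) (neg_one_eq_zeta_sq L) (complexConj_zeta_ne L) (map_vPrime L p h2))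
        (complexConj L))
      (localConj_ne_one (vPrime L p h2) (wPrime L p h2) (neg_one_eq_zeta_sq L).symm (span_pair_eq_top L (complexConj_zeta_ne L))
        (not_isSquare_of_staysPrime L (vPrime L p h2) (wPrime L p h2) (neg_one_eq_zeta_sq L) (complexConj_zeta_ne L) (map_vPrime L p h2))
        (complexConj L) (complexConj_apply_eq_neg L (neg_one_eq_zeta_sq L) (complexConj_zeta_ne L)))
    haveI := isDiscreteValuationRing_integralClosure_adicCompletion (vPrime L p h2) (wPrime L p h2)
    haveI := finite_residueField_integralClosure_adicCompletion (vPrime L p h2) (wPrime L p h2)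
    haveI : IsFractionRing (integralClosure ((vPrime L p h2).adicCompletionIntegers (maximalRealSubfield L))
        ((wPrime L p h2).adicCompletion L)) ((wPrime L p h2).adicCompletion L) :=
      integralClosure.isFractionRing_of_finite_extension ((vPrime L p h2).adicCompletion (maximalRealSubfield L))
        ((wPrime L p h2).adicCompletion L)
    ∃ (u₀ : ((vPrime L p h2).adicCompletionIntegers (maximalRealSubfield L))ˣ)
      (Φ : ↥(formUnitaryGroup (J3 (algebraMap ((vPrime L p h2).adicCompletionIntegers (maximalRealSubfield L))
        ((wPrime L p h2).adicCompletion L)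
        (u₀ : (vPrime L p h2).adicCompletionIntegers (maximalRealSubfield L))))) ≃*
        ↥(formUnitaryGroup (tensorGram L (vPrime L p h2) (gramToy L))))
      (ϖ' : integralClosure ((vPrime L p h2).adicCompletionIntegers (maximalRealSubfield L))
        ((wPrime L p h2).adicCompletion L))
      (hϖ' : Irreducible ϖ')
      (hs' : star (algebraMap (integralClosure ((vPrime L p h2).adicCompletionIntegers (maximalRealSubfield L))
        ((wPrime L p h2).adicCompletion L)) ((wPrime L p h2).adicCompletion L) ϖ') =
          algebraMap (integralClosure ((vPrime L p h2).adicCompletionIntegers (maximalRealSubfield L))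
            ((wPrime L p h2).adicCompletion L)) ((wPrime L p h2).adicCompletion L) ϖ'),
      (∀ g, g ∈ hyperspecialSubgroup
          (integralClosure ((vPrime L p h2).adicCompletionIntegers (maximalRealSubfield L))
            ((wPrime L p h2).adicCompletion L))
          (J3 (algebraMap ((vPrime L p h2).adicCompletionIntegers (maximalRealSubfield L))
            ((wPrime L p h2).adicCompletion L)
            (u₀ : (vPrime L p h2).adicCompletionIntegers (maximalRealSubfield L)))) ↔
          Φ g ∈ recordHyperspecial L (vPrime L p h2) l (gramToy L)) ∧
      ∀ {V : Type uV} [AddCommGroup V] [Module k V]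
        (ρ : Representation k (↥(formUnitaryGroup (tensorGram L (vPrime L p h2) (gramToy L)))) V) [ρ.IsIrreducible],
        KFinite ρ (recordHyperspecial L (vPrime L p h2) l (gramToy L)) →
        ∀ [FiniteDimensional k (invariants ρ (recordHyperspecial L (vPrime L p h2) l (gramToy L)))],
        invariants ρ (recordHyperspecial L (vPrime L p h2) l (gramToy L)) ≠ ⊥ →
        ∃ α : k, α ≠ 0 ∧ Nonempty (ρ.Equiv (comp Φ.symm
          (inertSphericalQuot
            (hstar_of_star_eq (localConj (vPrime L p h2) (wPrime L p h2) (neg_one_eq_zeta_sq L).symm (span_pair_eq_top L (complexConj_zeta_ne L))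
              (not_isSquare_of_staysPrime L (vPrime L p h2) (wPrime L p h2) (neg_one_eq_zeta_sq L) (complexConj_zeta_ne L) (map_vPrime L p h2))
              (complexConj L))
              (fun x => by
                rw [star_p8_eq_star L (vPrime L p h2) (wPrime L p h2) (neg_one_eq_zeta_sq L) (complexConj_zeta_ne L)
                  (not_isSquare_of_staysPrime L (vPrime L p h2) (wPrime L p h2) (neg_one_eq_zeta_sq L) (complexConj_zeta_ne L)
                    (map_vPrime L p h2))]
                rfl))
            (algebraMap ((vPrime L p h2).adicCompletionIntegers (maximalRealSubfield L))
              ((wPrime L p h2).adicCompletion L)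
              (u₀ : (vPrime L p h2).adicCompletionIntegers (maximalRealSubfield L)))
            (star_algebraMap_of_star_eq (localConj (vPrime L p h2) (wPrime L p h2) (neg_one_eq_zeta_sq L).symm
              (span_pair_eq_top L (complexConj_zeta_ne L))
              (not_isSquare_of_staysPrime L (vPrime L p h2) (wPrime L p h2) (neg_one_eq_zeta_sq L) (complexConj_zeta_ne L) (map_vPrime L p h2))
              (complexConj L))
              (fun x => by
                rw [star_p8_eq_star L (vPrime L p h2) (wPrime L p h2) (neg_one_eq_zeta_sq L) (complexConj_zeta_ne L)
                  (not_isSquare_of_staysPrime L (vPrime L p h2) (wPrime L p h2) (neg_one_eq_zeta_sq L) (complexConj_zeta_ne L)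
                    (map_vPrime L p h2))]
                rfl)
              (u₀ : (vPrime L p h2).adicCompletionIntegers (maximalRealSubfield L)))
            (algebraMap_unit_ne_zero (F := (vPrime L p h2).adicCompletion (maximalRealSubfield L)) u₀)
            (isInteger_algebraMap (u₀ : (vPrime L p h2).adicCompletionIntegers (maximalRealSubfield L)))
            (isInteger_algebraMap_unit_inv u₀) hϖ' hs' k (α * ((p : k) ^ 2)⁻¹)))) :=
  exists_mulEquiv_forall_nonempty_equiv_inertSphericalQuot_record_four_inert L p h2 (neg_one_eq_zeta_sq L)
    (complexConj_zeta_ne L) l k hl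

/-- **With the generators supplied** (file 235's `exists_fin_span_eq_top`): the whole hypothesis set of file 344's
statement is inhabited on `ℚ(i)` at EVERY inert place `(p)`, `p ≡ 3 (mod 4)`, with the explicit datum `(−1, ζ₄)`. -/
theorem exists_generators_and_mulEquiv_forall_nonempty_equiv_inertSphericalQuot_record_four_inert_zeta :
    ∃ (r : ℕ) (l : Fin r → 𝓞 L), Submodule.span (𝓞 (maximalRealSubfield L)) (Set.range l) = ⊤ ∧
      (letI := tensorStarRing L (vPrime L p h2)
      letI := starRingOfQuadratic (finrank_eq_two L (vPrime L p h2) (wPrime L p h2) (neg_one_eq_zeta_sq L) (complexConj_zeta_ne L)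
          (not_isSquare_of_staysPrime L (vPrime L p h2) (wPrime L p h2) (neg_one_eq_zeta_sq L) (complexConj_zeta_ne L) (map_vPrime L p h2)))
        (localConj (vPrime L p h2) (wPrime L p h2) (neg_one_eq_zeta_sq L).symm (span_pair_eq_top L (complexConj_zeta_ne L))
          (not_isSquare_of_staysPrime L (vPrime L p h2) (wPrime L p h2) (neg_one_eq_zeta_sq L) (complexConj_zeta_ne L) (map_vPrime L p h2))
          (complexConj L))
        (localConj_ne_one (vPrime L p h2) (wPrime L p h2) (neg_one_eq_zeta_sq L).symm (span_pair_eq_top L (complexConj_zeta_ne L))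
          (not_isSquare_of_staysPrime L (vPrime L p h2) (wPrime L p h2) (neg_one_eq_zeta_sq L) (complexConj_zeta_ne L) (map_vPrime L p h2))
          (complexConj L) (complexConj_apply_eq_neg L (neg_one_eq_zeta_sq L) (complexConj_zeta_ne L)))
      haveI := isDiscreteValuationRing_integralClosure_adicCompletion (vPrime L p h2) (wPrime L p h2)
      haveI := finite_residueField_integralClosure_adicCompletion (vPrime L p h2) (wPrime L p h2)
      haveI : IsFractionRing (integralClosure ((vPrime L p h2).adicCompletionIntegers (maximalRealSubfield L))
          ((wPrime L p h2).adicCompletion L)) ((wPrime L p h2).adicCompletion L) :=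
        integralClosure.isFractionRing_of_finite_extension ((vPrime L p h2).adicCompletion (maximalRealSubfield L))
          ((wPrime L p h2).adicCompletion L)
      ∃ (u₀ : ((vPrime L p h2).adicCompletionIntegers (maximalRealSubfield L))ˣ)
        (Φ : ↥(formUnitaryGroup (J3 (algebraMap ((vPrime L p h2).adicCompletionIntegers (maximalRealSubfield L))
          ((wPrime L p h2).adicCompletion L)
          (u₀ : (vPrime L p h2).adicCompletionIntegers (maximalRealSubfield L))))) ≃*
          ↥(formUnitaryGroup (tensorGram L (vPrime L p h2) (gramToy L))))
        (ϖ' : integralClosure ((vPrime L p h2).adicCompletionIntegers (maximalRealSubfield L))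
          ((wPrime L p h2).adicCompletion L))
        (hϖ' : Irreducible ϖ')
        (hs' : star (algebraMap (integralClosure ((vPrime L p h2).adicCompletionIntegers (maximalRealSubfield L))
          ((wPrime L p h2).adicCompletion L)) ((wPrime L p h2).adicCompletion L) ϖ') =
            algebraMap (integralClosure ((vPrime L p h2).adicCompletionIntegers (maximalRealSubfield L))
              ((wPrime L p h2).adicCompletion L)) ((wPrime L p h2).adicCompletion L) ϖ'),
        (∀ g, g ∈ hyperspecialSubgroup
            (integralClosure ((vPrime L p h2).adicCompletionIntegers (maximalRealSubfield L))
              ((wPrime L p h2).adicCompletion L))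
            (J3 (algebraMap ((vPrime L p h2).adicCompletionIntegers (maximalRealSubfield L))
              ((wPrime L p h2).adicCompletion L)
              (u₀ : (vPrime L p h2).adicCompletionIntegers (maximalRealSubfield L)))) ↔
            Φ g ∈ recordHyperspecial L (vPrime L p h2) l (gramToy L)) ∧
        ∀ {V : Type uV} [AddCommGroup V] [Module k V]
          (ρ : Representation k (↥(formUnitaryGroup (tensorGram L (vPrime L p h2) (gramToy L)))) V) [ρ.IsIrreducible],
          KFinite ρ (recordHyperspecial L (vPrime L p h2) l (gramToy L)) →
          ∀ [FiniteDimensional k (invariants ρ (recordHyperspecial L (vPrime L p h2) l (gramToy L)))],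
          invariants ρ (recordHyperspecial L (vPrime L p h2) l (gramToy L)) ≠ ⊥ →
          ∃ α : k, α ≠ 0 ∧ Nonempty (ρ.Equiv (comp Φ.symm
            (inertSphericalQuot
              (hstar_of_star_eq (localConj (vPrime L p h2) (wPrime L p h2) (neg_one_eq_zeta_sq L).symm (span_pair_eq_top L (complexConj_zeta_ne L))
                (not_isSquare_of_staysPrime L (vPrime L p h2) (wPrime L p h2) (neg_one_eq_zeta_sq L) (complexConj_zeta_ne L) (map_vPrime L p h2))
                (complexConj L))
                (fun x => by
                  rw [star_p8_eq_star L (vPrime L p h2) (wPrime L p h2) (neg_one_eq_zeta_sq L) (complexConj_zeta_ne L)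
                    (not_isSquare_of_staysPrime L (vPrime L p h2) (wPrime L p h2) (neg_one_eq_zeta_sq L) (complexConj_zeta_ne L)
                      (map_vPrime L p h2))]
                  rfl))
              (algebraMap ((vPrime L p h2).adicCompletionIntegers (maximalRealSubfield L))
                ((wPrime L p h2).adicCompletion L)
                (u₀ : (vPrime L p h2).adicCompletionIntegers (maximalRealSubfield L)))
              (star_algebraMap_of_star_eq (localConj (vPrime L p h2) (wPrime L p h2) (neg_one_eq_zeta_sq L).symm
                (span_pair_eq_top L (complexConj_zeta_ne L))
                (not_isSquare_of_staysPrime L (vPrime L p h2) (wPrime L p h2) (neg_one_eq_zeta_sq L) (complexConj_zeta_ne L) (map_vPrime L p h2))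
                (complexConj L))
                (fun x => by
                  rw [star_p8_eq_star L (vPrime L p h2) (wPrime L p h2) (neg_one_eq_zeta_sq L) (complexConj_zeta_ne L)
                    (not_isSquare_of_staysPrime L (vPrime L p h2) (wPrime L p h2) (neg_one_eq_zeta_sq L) (complexConj_zeta_ne L)
                      (map_vPrime L p h2))]
                  rfl)
                (u₀ : (vPrime L p h2).adicCompletionIntegers (maximalRealSubfield L)))
              (algebraMap_unit_ne_zero (F := (vPrime L p h2).adicCompletion (maximalRealSubfield L)) u₀)
              (isInteger_algebraMap (u₀ : (vPrime L p h2).adicCompletionIntegers (maximalRealSubfield L)))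
              (isInteger_algebraMap_unit_inv u₀) hϖ' hs' k (α * ((p : k) ^ 2)⁻¹))))) :=
  (exists_fin_span_eq_top L).elim fun r h => h.elim fun l hl =>
    ⟨r, l, hl, exists_mulEquiv_forall_nonempty_equiv_inertSphericalQuot_record_four_inert_zeta L p h2 l k hl⟩

end Generic

end Summit.Ventures.HodgeRepro2.T5RecordSphericalSpectrumFourInertPrime
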